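import Summits.QuantumFields.YangMills.Theorems.UnitScaleTiltProp8ChartHInvGeometry
import Summits.QuantumFields.YangMills.Theorems.UnitScaleTiltProp8ChartHInvComb
import HarnessLib

/-!
# Route `UnitScaleTilt`, crux K1 «MinimiserStabilityRegPr» (stmt-QuantumFields-19200), line «route-R» (`Lines/birth_routeR.lean` v2 5b75208179c6919a),
# stub P `stub_relPoincareOpt` — linear flat core, step N6-B1 of the P-lin-flat plan (CARD-19200-V3-g11): THE COMB MEAN KILLS DIRECTION-CONSTANT BOND
# FIELDS (centred blocks, `L` odd), hence is bounded by the OSCILLATION of the field on the block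

Cell `ym3-torus` ∕ fleet seat `ym-ust-19200-p1` (gen 11, route-R lead).  WHY.  The per-level term of the structure theorem's gauge function
(`Prop7IterLinStructureRec`, N6-A) is `L^j·combMean(Q_jY)(z)`; its `(H¹)^*`-bound (N6-B) goes through «subtract the block means, then Poincaré».  The
subtraction is free exactly because the staircases of [Balaban1987RG1] (0.3) start at the block CENTRE and the offsets `n = r − (L−1)/2` average to zero
(`L` odd): the signed sum of a direction-constant field `b ↦ c_{dir b}` along a walk is `Σ_κ netDisp_κ·c_κ`, along the staircase to offset `n` it is
`Σ_κ n_κ c_κ`, and `Σ_r n(r) = 0`.  So `combMean(W)(z) = combMean(W − c_{dir})(z)` for ANY constants `c`, and the local sup bound of the tree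
(`ChartHInv.norm_combMean_le_of_local`) bounds the comb mean by `(d+2)L` times the OSCILLATION `max_{b ⊂ B(z)} ‖W(b) − c_{dir b}‖`.

WHAT IS PROVED (sorry-free, no definition; [folklore] bookkeeping on the tree's (0.3)/(0.4) letters):
* §1 `walkSum_dirConst` (`Σ_{b⊂Γ} ±c_{dir b} = Σ_κ netDisp(Γ)_κ·c_κ`), `sum_off_eq_zero` (`Σ_{r} n(r)_κ = 0`, `L` odd), **`combMean_dirConst`** (`= 0`),
  `combMean_sub_dirConst` (`combMean W = combMean (W − c_{dir})`).
* §2 **`norm_combMean_le_osc`**: `‖combMean W z‖ ≤ (d+2)L·a` whenever `‖W(b) − c_{dir b}‖ ≤ a` on the bonds with both end-points in `B(z)`;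
  **`norm_nsmul_combMean_bondAvgIter_le_osc`**: the per-level term, `‖L^j·combMean(Q_jY)(z)‖ ≤ L^j(d+2)L·a` under the same oscillation hypothesis on `Q_jY`.

References: T. Bałaban, CMP 109 (1987) 249–301 [Balaban1987RG1] ((0.3)–(0.4) pp.252–253); CMP 98 (1985) 17–51 [Balaban1985Averaging] ((62) p.28);
CMP 95 (1984) 17–40 [Balaban1984PropagatorsI] ((1.8) p.19, (1.18) p.20).
-/

noncomputable section

open scoped BigOperators Matrix.Norms.L2Operator Matrix

namespace Summit.QuantumFields.YangMills.Theorems.Prop7CombMeanCentred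

open Literature.MathematicalPhysics.QuantumFieldTheory.Balaban1983to89
open T4Continuum BlockAveraging BlockAveragingEMLLinearised LatticeFieldCalculus
open Summit.QuantumFields.YangMills.Theorems.ChartHInv (combMean_sub norm_combMean_le_of_local)

variable {P : Params} {n : Type*}

/-! ## §1 Direction-constant fields: walk sums are net displacements; the centred offsets average to zero -/

section DirConst

variable {V : Type*} [AddCommGroup V]

/-- **THE SIGNED SUM OF A DIRECTION-CONSTANT FIELD ALONG A WALK IS THE NET DISPLACEMENT**: `Σ_{b⊂Γ} ±c_{dir b} = Σ_κ netDisp(Γ)_κ·c_κ`.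
[cite: Balaban1984PropagatorsI, (1.8) p.19 (bookkeeping)] -/
theorem walkSum_dirConst {j : ℕ} (c : Fin P.d → V) :
    ∀ (x : Site P j) (w : List (Letter P.d)), walkSum (fun b : PBond P j => c b.dir) (walk x w) = ∑ κ : Fin P.d, (netDisp w κ) • c κ
  | x, [] => by simp [walk]
  | x, (μ, true) :: w => by
    simp only [walk, walkSum_cons, ↓reduceIte]
    rw [walkSum_dirConst c (x.shift μ) w]
    simp only [netDisp_cons, ↓reduceIte, add_smul, Finset.sum_add_distrib, ite_smul, one_smul, zero_smul,
      Finset.sum_ite_eq, Finset.mem_univ]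
  | x, (μ, false) :: w => by
    simp only [walk, walkSum_cons, Bool.false_eq_true, ↓reduceIte]
    rw [walkSum_dirConst c (x.unshift μ) w]
    simp only [netDisp_cons, Bool.false_eq_true, ↓reduceIte, add_smul, Finset.sum_add_distrib, ite_smul, neg_smul, one_smul,
      zero_smul, Finset.sum_ite_eq, Finset.mem_univ]

end DirConst

/-- Summing a function of one coordinate over the offset cube gives `L^{d−1}` copies of the one-dimensional sum. [folklore] -/
theorem sum_pi_apply_eq {M : Type*} [AddCommMonoid M] (κ : Fin P.d) (g : Fin P.L → M) :
    ∑ r : Fin P.d → Fin P.L, g (r κ) = (P.L ^ (P.d - 1)) • ∑ t : Fin P.L, g t := by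
  classical
  rw [← Finset.sum_fiberwise_of_maps_to (s := (Finset.univ : Finset (Fin P.d → Fin P.L))) (t := (Finset.univ : Finset (Fin P.L)))
    (g := fun r => r κ) (fun _ _ => Finset.mem_univ _)]
  rw [Finset.smul_sum]
  refine Finset.sum_congr rfl fun t _ => ?_
  have hc : ∀ r ∈ (Finset.univ : Finset (Fin P.d → Fin P.L)).filter (fun r => r κ = t), g (r κ) = g t := fun r hr => by
    rw [(Finset.mem_filter.mp hr).2]
  rw [Finset.sum_congr rfl hc, Finset.sum_const]
  congr 1
  -- the fibre `{r : r κ = t}` has `L^{d−1}` elements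
  have hcard : ((Finset.univ : Finset (Fin P.d → Fin P.L)).filter (fun r => r κ = t)).card * P.L = P.L ^ P.d := by
    have h := Finset.card_eq_sum_card_fiberwise (s := (Finset.univ : Finset (Fin P.d → Fin P.L))) (t := (Finset.univ : Finset (Fin P.L)))
      (f := fun r => r κ) (fun _ _ => Finset.mem_univ _)
    -- all fibres have the same size (translate by the difference in coordinate `κ`)
    have hsame : ∀ t' : Fin P.L, ((Finset.univ : Finset (Fin P.d → Fin P.L)).filter (fun r => r κ = t')).card
        = ((Finset.univ : Finset (Fin P.d → Fin P.L)).filter (fun r => r κ = t)).card := by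
      intro t'
      refine Finset.card_bij (fun r _ => Function.update r κ t) (fun r hr => ?_) (fun r₁ hr₁ r₂ hr₂ h => ?_) (fun r hr => ?_)
      · simp
      · have h1 := (Finset.mem_filter.mp hr₁).2
        have h2 := (Finset.mem_filter.mp hr₂).2
        funext ν
        by_cases hν : ν = κ
        · subst hν; rw [h1, h2]
        · have := congrFun h ν
          simpa [Function.update_of_ne hν] using this
      · refine ⟨Function.update r κ t', by simp, ?_⟩
        have hr' := (Finset.mem_filter.mp hr).2
        funext ν
        by_cases hν : ν = κ
        · subst hν; simp [hr']
        · simp [Function.update_of_ne hν]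
    rw [Finset.card_univ, Fintype.card_fun, Fintype.card_fin, Fintype.card_fin] at h
    rw [Finset.sum_congr rfl fun t' _ => hsame t', Finset.sum_const, Finset.card_univ, Fintype.card_fin, smul_eq_mul] at h
    rw [h, mul_comm]
  have hL : 0 < P.L := P.L_pos
  have hd : P.L ^ P.d = P.L ^ (P.d - 1) * P.L := by
    rw [← pow_succ]
    congr 1
    have := P.hd
    omega
  rw [hd] at hcard
  exact Nat.eq_of_mul_eq_mul_right hL hcard

/-- **THE CENTRED OFFSETS AVERAGE TO ZERO** (`L` odd): `Σ_{r ∈ [0,L)^d} (r_κ − (L−1)/2) = 0`. [cite: Balaban1987RG1, (0.3) p.252] -/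
theorem sum_off_eq_zero (κ : Fin P.d) : ∑ r : Fin P.d → Fin P.L, off r κ = 0 := by
  simp only [off]
  rw [sum_pi_apply_eq κ (fun t : Fin P.L => ((t : ℕ) : ℤ) - (((P.L - 1) / 2 : ℕ) : ℤ))]
  suffices h : ∑ t : Fin P.L, (((t : ℕ) : ℤ) - (((P.L - 1) / 2 : ℕ) : ℤ)) = 0 by rw [h, smul_zero]
  rw [Finset.sum_sub_distrib, Finset.sum_const, Finset.card_univ, Fintype.card_fin, sub_eq_zero, Fin.sum_univ_eq_sum_range (fun t => ((t : ℕ) : ℤ)),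
    nsmul_eq_mul]
  -- `Σ_{t<L} t = L·(L−1)/2` and `L` is odd
  obtain ⟨h, hh⟩ := P.hL.1
  have hsum : ∑ t ∈ Finset.range P.L, ((t : ℕ) : ℤ) = ((P.L * (P.L - 1) / 2 : ℕ) : ℤ) := by
    have e2 : (∑ i ∈ Finset.range P.L, i) = P.L * (P.L - 1) / 2 := by
      have := Finset.sum_range_id_mul_two P.L
      omega
    rw [← Nat.cast_sum, e2]
  rw [hsum, hh]
  have e3 : ((2 * h + 1) * (2 * h + 1 - 1) / 2 : ℕ) = (2 * h + 1) * h := by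
    rw [show 2 * h + 1 - 1 = 2 * h from by omega, show (2 * h + 1) * (2 * h) = ((2 * h + 1) * h) * 2 from by ring,
      Nat.mul_div_cancel _ two_pos]
  have e4 : ((2 * h + 1 - 1) / 2 : ℕ) = h := by
    rw [show 2 * h + 1 - 1 = 2 * h from by omega, Nat.mul_div_cancel_left _ two_pos]
  rw [e3, e4]
  push_cast
  ring

variable [Fintype n] [DecidableEq n]

omit [Fintype n] [DecidableEq n] in
/-- **THE COMB MEAN OF A DIRECTION-CONSTANT FIELD VANISHES** (centred blocks, `L` odd): along the staircase to offset `n` the field `b ↦ c_{dir b}` sums to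
`Σ_κ n_κ c_κ` (`netDisp_stairWord`), and the offsets average to zero. [cite: Balaban1987RG1, (0.3)-(0.4) pp.252-253; Balaban1985Averaging, (62) p.28] -/
theorem combMean_dirConst {j : ℕ} (c : Fin P.d → Matrix n n ℂ) (z : Site P (j + 1)) :
    combMean (fun b : PBond P j => c b.dir) z = 0 := by
  rw [combMean_def]
  have hterm : ∀ i : Idx P, walkSum (fun b : PBond P j => c b.dir) (walk (emb z) (stairWord i.2.1 (off i.1)))
      = ∑ κ : Fin P.d, (off i.1 κ) • c κ := fun i => by
    rw [walkSum_dirConst]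
    exact Finset.sum_congr rfl fun κ _ => by rw [netDisp_stairWord]
  rw [Finset.sum_congr rfl fun i _ => hterm i, sum_idx_of_fst (fun r => ∑ κ : Fin P.d, (off r κ) • c κ), Finset.sum_comm]
  have h0 : ∀ κ : Fin P.d, ∑ r : Fin P.d → Fin P.L, (off r κ) • c κ = 0 := fun κ => by
    rw [← Finset.sum_smul, sum_off_eq_zero, zero_smul]
  simp [h0]

omit [Fintype n] [DecidableEq n] in
/-- **CENTRING IS FREE**: `combMean W z = combMean (W − c_{dir})(z)` for every family of constants `c`. [cite: Balaban1985Averaging, (62) p.28] -/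
theorem combMean_sub_dirConst {j : ℕ} (W : PBond P j → Matrix n n ℂ) (c : Fin P.d → Matrix n n ℂ) (z : Site P (j + 1)) :
    combMean W z = combMean (fun b : PBond P j => W b - c b.dir) z := by
  rw [combMean_sub W (fun b : PBond P j => c b.dir) z, combMean_dirConst, sub_zero]

/-! ## §2 The comb mean is bounded by the oscillation of the field on the block -/

/-- **`‖combMean W z‖ ≤ (d+2)L·a` IF THE FIELD OSCILLATES BY AT MOST `a` AROUND DIRECTION CONSTANTS ON THE BLOCK**: `‖W(b) − c_{dir b}‖ ≤ a` for the bonds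
with both end-points in `B(z)` (centring §1 + the tree's local sup bound `ChartHInv.norm_combMean_le_of_local`). [cite: Balaban1985Averaging, (62) p.28] -/
theorem norm_combMean_le_osc {j : ℕ} (hj : j + 1 ≤ P.m + P.K) (W : PBond P j → Matrix n n ℂ) (c : Fin P.d → Matrix n n ℂ) (z : Site P (j + 1))
    {a : ℝ} (ha : 0 ≤ a) (h : ∀ b : PBond P j, blockOf b.src = z → blockOf b.tgt = z → ‖W b - c b.dir‖ ≤ a) :
    ‖combMean W z‖ ≤ ((P.d + 2) * P.L : ℕ) * a := by
  rw [combMean_sub_dirConst W c z]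
  exact norm_combMean_le_of_local hj (fun b : PBond P j => W b - c b.dir) z ha h

/-- **THE PER-LEVEL TERM OF THE STRUCTURE THEOREM'S GAUGE FUNCTION** (`Prop7IterLinStructureRec`): `‖L^j·combMean(Q_jY)(z)‖ ≤ L^j·(d+2)L·a` whenever the
`j`-fold straight average `Q_jY` oscillates by at most `a` around direction constants on the level-`j` bonds of `B(z)` — the sup∕oscillation form to which the
`ℓ²` Poincaré estimate of N6-B2 is applied. [cite: Balaban1984PropagatorsI, (1.18) p.20; Balaban1985Averaging, (62) p.28] -/
theorem norm_nsmul_combMean_bondAvgIter_le_osc {j : ℕ} (hj : j + 1 ≤ P.m + P.K) (Y : PBond P 0 → Matrix n n ℂ) (c : Fin P.d → Matrix n n ℂ)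
    (z : Site P (j + 1)) {a : ℝ} (ha : 0 ≤ a)
    (h : ∀ b : PBond P j, blockOf b.src = z → blockOf b.tgt = z → ‖bondAvgIter j Y b - c b.dir‖ ≤ a) :
    ‖(P.L ^ j : ℕ) • combMean (bondAvgIter j Y) z‖ ≤ (P.L ^ j : ℕ) * (((P.d + 2) * P.L : ℕ) * a) := by
  rw [← Nat.cast_smul_eq_nsmul ℝ, norm_smul, Real.norm_natCast]
  exact mul_le_mul_of_nonneg_left (norm_combMean_le_osc hj _ c z ha h) (Nat.cast_nonneg _)

end Summit.QuantumFields.YangMills.Theorems.Prop7CombMeanCentred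

end
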